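import Summits.CriticalPhenomena.PercolationContinuityZ3.Theorems.SahiMasterFamilyTotalCumulance

/-!
# Sahi positivity TENSORISES on product-form families (every order, no FKG hypothesis on the factors)

Companion of `SahiMasterFamilyTotalCumulance.lean` (crux `NoHeavyLowerTail`, stmt-CriticalPhenomena-4575; cell `prim-masterthm`, seat P4,
unit `prim-masterthm-p4-g3`): the corollaries of the law of total cumulance
`E_{n+1}^{μ⊗ν}(f) = Σ_π E^ν_{|π|}(condE μ f B : B ∈ π)` for PRODUCT-FORM slots `f_i(x,y) = φ_i(x)·ψ_i(y)`.

* `condE_tensor` — the conditional inner functional of a block factors: `condE μ (φ⊗ψ) B (y) = (Π_{i∈B} ψ_i(y))·E^μ_{|B|}(φ_B)`.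
* `sahiE_prod_tensor_eq` — hence `E^{μ⊗ν}_{n+1}(φ⊗ψ) = Σ_π [Π_{B∈π} E^μ_{|B|}(φ_B)]·E^ν_{|π|}(Π_{i∈B} ψ_i : B ∈ π)`
  (any real weights, any functions).
* `sahiE_prod_tensor_nonneg` / `sahiE_prod_tensor_nonneg'` — **tensorisation of Sahi positivity**: if every sub-family functional of `φ`
  under `μ` is `≥ 0` (e.g. `μ` Sahi-positive of all orders `≤ n+1` on a preorder and `φ_i` nonnegative monotone) and `ν` is Sahi-positive of
  all orders `≤ n+1` on a preorder `β` with `ψ_i` nonnegative monotone, then `E^{μ⊗ν}_{n+1}(φ_0ψ_0,…,φ_nψ_n) ≥ 0`.  Neither factor needs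
  to be a lattice or FKG: Sahi positivity of the two marginal laws is all that enters.
* `sahiE_prod_blocks_nonneg` — the **block stratum** of the master-family induction on `k` (MASTER-ROUTES §P4): a family on `γ × β` whose
  slots `i` with `b i` depend on `x` only and the others on `y` only has `E ≥ 0` as soon as both marginal laws are Sahi-positive of the
  orders involved — the `k`-uniform generalisation of the tree's independent splitting `E_{k+1}(U,V) = (k−1)P(V)E_k(U)`
  (`IndependentSplitting.sahiE_cons_eq_of_indepHead`, the case of a single `y`-slot) to two independent GROUPS of slots.  For product
  measures on a cube this is the stratum "the dependency graph of the family is disconnected".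
Iterating `sahiE_prod_tensor_nonneg'` over the coordinates of `{0,1}^E` (each factor a two-point chain, on which every nonnegative weight is
Sahi-positive of all orders) gives Sahi positivity of every order, for every product measure, on the cone spanned by the monomials `x^A` —
Sahi's cumulation theorem [Sahi2008, Thm. 2] in the product-measure case, by a route different from Sahi's (not re-derived here).
Everything is proved; no named facts. [this work]
-/

noncomputable section

namespace Summit.CriticalPhenomena.PercolationContinuityZ3.Theorems

open Finset Function
open Literature.Combinatorics.Sahi2008
open Literature.Combinatorics.Sahi2008.PartitionForm

namespace SahiTotalCumulance

variable {γ β : Type*} [Fintype γ] [Fintype β]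

/-! ### Pulling slotwise scalars out of `E_k` -/

omit [Fintype β] in
/-- `E_k` is homogeneous in every slot: scaling the slots in `s` scales `E_k` by the product of the scalars. [folklore] -/
theorem sahiE_smul_slots (μ : γ → ℝ) {k : ℕ} (c : Fin k → ℝ) (g : Fin k → γ → ℝ) (s : Finset (Fin k)) :
    sahiE μ k (fun j => if j ∈ s then c j • g j else g j) = (∏ j ∈ s, c j) * sahiE μ k g := by
  classical
  induction s using Finset.induction_on with
  | empty => simp
  | insert a s ha ih =>
    have hfam : (fun j => if j ∈ insert a s then c j • g j else g j) =
        update (fun j => if j ∈ s then c j • g j else g j) a (c a • g a) := by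
      funext j
      by_cases hja : j = a
      · subst hja; simp
      · rw [update_of_ne hja]; simp [mem_insert, hja]
    have hback : update (fun j => if j ∈ s then c j • g j else g j) a (g a) =
        (fun j => if j ∈ s then c j • g j else g j) := by
      funext j
      by_cases hja : j = a
      · subst hja; simp [ha]
      · rw [update_of_ne hja]
    rw [hfam, sahiE_update_smul, hback, ih, prod_insert ha, mul_assoc]

omit [Fintype β] in
/-- `E_k(c_0 φ_0,…,c_{k−1} φ_{k−1}) = (Π_j c_j)·E_k(φ)`. [folklore] -/
theorem sahiE_smul_family (μ : γ → ℝ) {k : ℕ} (c : Fin k → ℝ) (g : Fin k → γ → ℝ) :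
    sahiE μ k (fun j => c j • g j) = (∏ j, c j) * sahiE μ k g := by
  have h := sahiE_smul_slots μ c g univ
  simpa only [mem_univ, if_true] using h

/-! ### Product-form families -/

omit [Fintype β] in
/-- **The conditional functional of a block factors for product-form slots**:
`condE μ (φ⊗ψ) S (y) = (Π_{j} ψ_{e_S(j)}(y))·E^μ_{|S|}(φ_S)`. [this work] -/
theorem condE_tensor (μ : γ → ℝ) {N : ℕ} (φ : Fin N → γ → ℝ) (ψ : Fin N → β → ℝ) (S : Finset (Fin N)) (y : β) :
    condE μ (fun i (p : γ × β) => φ i p.1 * ψ i p.2) S y =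
      (∏ j : Fin S.card, ψ (S.orderEmbOfFin rfl j) y) * sahiE μ S.card (fun j => φ (S.orderEmbOfFin rfl j)) := by
  unfold condE
  have hfam : secFam (fun i (p : γ × β) => φ i p.1 * ψ i p.2) S y =
      fun j => (ψ (S.orderEmbOfFin rfl j) y) • φ (S.orderEmbOfFin rfl j) := by
    funext j x
    simp only [secFam, Pi.smul_apply, smul_eq_mul]
    ring
  rw [hfam, sahiE_smul_family]

/-- **Tensor form of the law of total cumulance**: for product-form slots,
`E^{μ⊗ν}_{n+1}(φ⊗ψ) = Σ_π [Π_{B∈π} E^μ_{|B|}(φ_B)] · E^ν_{|π|}(Π_{i∈B} ψ_i : B ∈ π)`. [this work] -/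
theorem sahiE_prod_tensor_eq (μ : γ → ℝ) (ν : β → ℝ) (n : ℕ) (φ : Fin (n + 1) → γ → ℝ) (ψ : Fin (n + 1) → β → ℝ) :
    sahiE (fun p : γ × β => μ p.1 * ν p.2) (n + 1) (fun i p => φ i p.1 * ψ i p.2) =
      ∑ c : OrderedFinpartition (n + 1),
        (∏ m : Fin c.length, sahiE μ (block c m).card (fun j => φ ((block c m).orderEmbOfFin rfl j))) *
          sahiE ν c.length (fun m y => ∏ j : Fin (block c m).card, ψ ((block c m).orderEmbOfFin rfl j) y) := by
  rw [sahiE_prod_eq_sum_partition]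
  refine sum_congr rfl fun c _ => ?_
  unfold termT
  have hfam : (fun m => condE μ (fun i (p : γ × β) => φ i p.1 * ψ i p.2) (block c m)) =
      fun m => (sahiE μ (block c m).card (fun j => φ ((block c m).orderEmbOfFin rfl j))) •
        fun y => ∏ j : Fin (block c m).card, ψ ((block c m).orderEmbOfFin rfl j) y := by
    funext m y
    rw [condE_tensor]
    simp only [Pi.smul_apply, smul_eq_mul]
    ring
  rw [hfam, sahiE_smul_family]

omit [Fintype γ] [Fintype β] in
/-- A finite product of nonnegative monotone functions is monotone. [folklore] -/
theorem monotone_prod_of_nonneg [Preorder β] {ι : Type*} (s : Finset ι) (G : ι → β → ℝ) (h0 : ∀ i y, 0 ≤ G i y)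
    (hm : ∀ i, Monotone (G i)) : Monotone fun y => ∏ i ∈ s, G i y :=
  fun _ _ hyy' => prod_le_prod (fun i _ => h0 i _) (fun i _ => hm i hyy')

/-- **Sahi positivity tensorises** (general form): if every sub-family functional of `φ` under `μ` is nonnegative and `ν` is Sahi-positive
of all orders `≤ n + 1` on a preorder, then for nonnegative monotone `ψ_i`, `E^{μ⊗ν}_{n+1}(φ_0ψ_0,…,φ_nψ_n) ≥ 0`. [this work] -/
theorem sahiE_prod_tensor_nonneg [Preorder β] (μ : γ → ℝ) (ν : β → ℝ) (n : ℕ) (φ : Fin (n + 1) → γ → ℝ)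
    (ψ : Fin (n + 1) → β → ℝ)
    (hφ : ∀ S : Finset (Fin (n + 1)), 0 ≤ sahiE μ S.card (fun j => φ (S.orderEmbOfFin rfl j)))
    (hν : ∀ L ≤ n + 1, SahiPositive ν L) (hψ0 : ∀ i y, 0 ≤ ψ i y) (hψm : ∀ i, Monotone (ψ i)) :
    0 ≤ sahiE (fun p : γ × β => μ p.1 * ν p.2) (n + 1) (fun i p => φ i p.1 * ψ i p.2) := by
  rw [sahiE_prod_tensor_eq]
  refine sum_nonneg fun c _ => mul_nonneg (prod_nonneg fun m _ => hφ _) ?_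
  have hlen : c.length ≤ n + 1 := c.length_le
  refine hν c.length hlen _ (fun m y => prod_nonneg fun j _ => hψ0 _ _) fun m => ?_
  exact monotone_prod_of_nonneg univ (fun j => ψ ((block c m).orderEmbOfFin rfl j)) (fun j y => hψ0 _ _) fun j => hψm _

/-- **Sahi positivity tensorises**: `μ` Sahi-positive of all orders `≤ n+1` on a preorder `γ`, `ν` likewise on `β`, `φ_i`, `ψ_i` nonnegative
monotone ⇒ `E^{μ⊗ν}_{n+1}(φ_0ψ_0,…,φ_nψ_n) ≥ 0` (the product weight on `γ × β`, componentwise order).  No lattice/FKG hypothesis. [this work] -/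
theorem sahiE_prod_tensor_nonneg' [Preorder γ] [Preorder β] (μ : γ → ℝ) (ν : β → ℝ) (n : ℕ)
    (hμ : ∀ L ≤ n + 1, SahiPositive μ L) (hν : ∀ L ≤ n + 1, SahiPositive ν L)
    (φ : Fin (n + 1) → γ → ℝ) (ψ : Fin (n + 1) → β → ℝ)
    (hφ0 : ∀ i x, 0 ≤ φ i x) (hφm : ∀ i, Monotone (φ i)) (hψ0 : ∀ i y, 0 ≤ ψ i y) (hψm : ∀ i, Monotone (ψ i)) :
    0 ≤ sahiE (fun p : γ × β => μ p.1 * ν p.2) (n + 1) (fun i p => φ i p.1 * ψ i p.2) := by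
  refine sahiE_prod_tensor_nonneg μ ν n φ ψ (fun S => ?_) hν hψ0 hψm
  have hS : S.card ≤ n + 1 := by
    have := card_le_univ S
    rwa [Fintype.card_fin] at this
  exact hμ S.card hS _ (fun j x => hφ0 _ _) fun j => hφm _

/-- **The block stratum of the induction on `k`**: a family on `γ × β` whose slots with `b i` depend on the `γ`-coordinate only and the
others on the `β`-coordinate only (two INDEPENDENT groups of slots under the product weight) has `E_{n+1} ≥ 0` whenever both marginal laws are
Sahi-positive of all orders `≤ n + 1` and the slots are nonnegative monotone.  (`IndependentSplitting.sahiE_cons_eq_of_indepHead` is the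
case of a single `β`-slot.) [this work] -/
theorem sahiE_prod_blocks_nonneg [Preorder γ] [Preorder β] (μ : γ → ℝ) (ν : β → ℝ) (n : ℕ)
    (hμ : ∀ L ≤ n + 1, SahiPositive μ L) (hν : ∀ L ≤ n + 1, SahiPositive ν L)
    (b : Fin (n + 1) → Prop) [DecidablePred b] (φ : Fin (n + 1) → γ → ℝ) (ψ : Fin (n + 1) → β → ℝ)
    (hφ0 : ∀ i x, 0 ≤ φ i x) (hφm : ∀ i, Monotone (φ i)) (hψ0 : ∀ i y, 0 ≤ ψ i y) (hψm : ∀ i, Monotone (ψ i)) :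
    0 ≤ sahiE (fun p : γ × β => μ p.1 * ν p.2) (n + 1) (fun i p => if b i then φ i p.1 else ψ i p.2) := by
  have hfam : (fun i (p : γ × β) => if b i then φ i p.1 else ψ i p.2) =
      fun i p => (if b i then φ i p.1 else 1) * (if b i then (1 : ℝ) else ψ i p.2) := by
    funext i p
    split_ifs <;> simp
  rw [hfam]
  refine sahiE_prod_tensor_nonneg' μ ν n hμ hν (fun i x => if b i then φ i x else 1) (fun i y => if b i then (1 : ℝ) else ψ i y)
    (fun i x => ?_) (fun i => ?_) (fun i y => ?_) (fun i => ?_)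
  · split_ifs
    · exact hφ0 i x
    · exact zero_le_one
  · by_cases hb : b i
    · simpa [hb] using hφm i
    · simp only [hb, if_false]; exact monotone_const
  · split_ifs
    · exact zero_le_one
    · exact hψ0 i y
  · by_cases hb : b i
    · simp only [hb, if_true]; exact monotone_const
    · simpa [hb] using hψm i

end SahiTotalCumulance

end Summit.CriticalPhenomena.PercolationContinuityZ3.Theorems

end
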